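import Mathlib.MeasureTheory.Measure.Haar.Unique
import Mathlib.MeasureTheory.Group.LIntegral
import Literature.Analysis.FunctionSpaces.PlancherelL1L2
import Literature.Analysis.FluidPDE.TaoAveragedCascade
import HarnessLib

/-!
# Conjugation symmetry of the `L²` Fourier transform and `H¹⁰_df ⊗ ℂ = H¹⁰_df ⊕ i H¹⁰_df`

Infrastructure for the discharge of the named facts in the decomposition of Tao's Theorem 3.2
(T. Tao, *Finite time blowup for an averaged three-dimensional Navier–Stokes equation*,
J. Amer. Math. Soc. **29** (2016), 601–674 = arXiv:1402.0290v3, §3.1, held as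
`paper:arxiv-1402.0290`), over the setting of `TaoAveragedSobolev.lean` (`L2C = L²(ℝ³; ℂ³)`,
`fourierFn`, `IsReal`, `IsFourierDivFree`, `MemH10df`) and `TaoAveragedCascade.lean`
(`MemH10dfC`):

* `conj3` — coordinatewise complex conjugation of `ℂ³`, a real linear isometry;
  `conjL2 u = ū`, `reflectL2 u = u(-·)` on `L²(ℝ³; ℂ³)`;
* `fourierIntegral_conj3_comp` — `𝓕(ū)(ξ) = \overline{𝓕u(-ξ)}` for the Fourier integral, and
  `fourier_conjL2` — **the same identity for Mathlib's `L²` Fourier transform**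
  (`MeasureTheory.Lp.fourierTransformₗᵢ`, defined by extension from Schwartz functions), proved by
  Schwartz density (`SchwartzMap.denseRange_toLpCLM`) from the `L¹ ∩ L²` bridge
  `Literature.Analysis.FunctionSpaces.fourier_toLp_ae_eq_fourierIntegral`;
* `MemH10dfC.conj`, `MemH10dfC.add`, `MemH10dfC.smul` — `H¹⁰_df ⊗ ℂ` is a `ℂ`-subspace of `L²`
  stable under conjugation;
* `MemH10dfC.decompose` — **every `w ∈ H¹⁰_df ⊗ ℂ` is `w₁ + i w₂` with `w₁ = Re w`, `w₂ = Im w`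
  in `H¹⁰_df`** (real, finite `H¹⁰` norm, divergence free). This is the content of the named
  fact `memH10dfC_decomposition` of the decomposition of Theorem 3.2 (proposed file
  `TaoAveragedComplexAverage.lean`), proved here in explicit form.

## References

* T. Tao, J. Amer. Math. Soc. 29 (2016), 601–674, §1.1 p. 6 ("real" multipliers,
  `m(-ξ) = \overline{m(ξ)}`), §3.1 p. 15 (complexification `H¹⁰_df ⊗ ℂ`). Key `Tao2016AveragedNS`.
* Standard: `\widehat{\bar f}(ξ) = \overline{\hat f(-ξ)}`, e.g. L. Grafakos, *Classical Fourier
  Analysis*, Prop. 2.2.11 (5).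
-/

noncomputable section

open MeasureTheory Set Filter FourierTransform
open scoped ENNReal NNReal SchwartzMap ComplexConjugate RealInnerProductSpace

namespace Literature.Analysis.FluidPDE.Tao2016

/-- Local notation for physical / frequency space `ℝ³`. -/
local notation "ℝ³" => EuclideanSpace ℝ (Fin 3)
/-- Local notation for the complexified range `ℂ³`. -/
local notation "ℂ³" => EuclideanSpace ℂ (Fin 3)

/-! ### Conjugation on `ℂ³` and on `L²(ℝ³; ℂ³)` -/

/-- Coordinatewise complex conjugation `z ↦ z̄` of `ℂ³`, a real linear isometry. [folklore] -/
def conj3 : ℂ³ →ₗᵢ[ℝ] ℂ³ where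
  toFun z := WithLp.toLp 2 fun i => conj (z i)
  map_add' z w := by
    ext i
    simp
  map_smul' c z := by
    ext i
    simp
  norm_map' z := by
    simp [EuclideanSpace.norm_eq]

/-- Coordinates of the conjugate: `(z̄)ᵢ = \overline{zᵢ}`. [folklore] -/
@[simp]
theorem conj3_apply (z : ℂ³) (i : Fin 3) : conj3 z i = conj (z i) := rfl

/-- Conjugation is an involution. [folklore] -/
@[simp]
theorem conj3_conj3 (z : ℂ³) : conj3 (conj3 z) = z := by
  ext i
  simp

/-- Conjugation is conjugate-linear over `ℂ`. [folklore] -/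
theorem conj3_smul (c : ℂ) (z : ℂ³) : conj3 (c • z) = conj c • conj3 z := by
  ext i
  simp

/-- The complex bilinear dot product with a conjugate: `a · b̄ = \overline{ā · b}`. [folklore] -/
theorem cdot_conj3_right (a b : ℂ³) : cdot a (conj3 b) = conj (cdot (conj3 a) b) := by
  simp [cdot, map_sum]

/-- A real vector is fixed by conjugation. [folklore] -/
@[simp]
theorem conj3_complexify (ξ : ℝ³) : conj3 (FunctionSpaces.EuclideanSpace.complexify ξ) =
    FunctionSpaces.EuclideanSpace.complexify ξ := by
  ext i
  simp

/-- **Complex conjugation of fields**, `ū(x) = \overline{u(x)}`, on `L²(ℝ³; ℂ³)`. [folklore] -/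
def conjL2 (u : L2C) : L2C :=
  (conj3.toContinuousLinearMap).compLp u

/-- `ū = conj ∘ u` almost everywhere. [folklore] -/
theorem coeFn_conjL2 (u : L2C) :
    (conjL2 u : ℝ³ → ℂ³) =ᵐ[volume] fun x => conj3 ((u : ℝ³ → ℂ³) x) :=
  ContinuousLinearMap.coeFn_compLp _ _

/-- Conjugation of fields is continuous on `L²`. [folklore] -/
theorem continuous_conjL2 : Continuous conjL2 :=
  (ContinuousLinearMap.compLpL 2 (volume : Measure ℝ³) conj3.toContinuousLinearMap).continuous

/-- Conjugation of fields is additive. [folklore] -/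
theorem conjL2_add (u v : L2C) : conjL2 (u + v) = conjL2 u + conjL2 v :=
  map_add (ContinuousLinearMap.compLpL 2 (volume : Measure ℝ³) conj3.toContinuousLinearMap) u v

/-- **Reflection of fields**, `u(-x)`, on `L²(ℝ³; ℂ³)` (Lebesgue measure is invariant under
`x ↦ -x`). [folklore] -/
def reflectL2 (u : L2C) : L2C :=
  Lp.compMeasurePreserving (fun x : ℝ³ => -x) (Measure.measurePreserving_neg _) u

/-- `reflectL2 u = u(-·)` almost everywhere. [folklore] -/
theorem coeFn_reflectL2 (u : L2C) :
    (reflectL2 u : ℝ³ → ℂ³) =ᵐ[volume] fun x => (u : ℝ³ → ℂ³) (-x) :=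
  Lp.coeFn_compMeasurePreserving u (Measure.measurePreserving_neg _)

/-- Reflection of fields is continuous on `L²`. [folklore] -/
theorem continuous_reflectL2 : Continuous reflectL2 :=
  (Lp.compMeasurePreservingₗᵢ ℂ (fun x : ℝ³ => -x)
    (Measure.measurePreserving_neg (volume : Measure ℝ³)) :
      L2C →ₗᵢ[ℂ] L2C).continuous

/-! ### `𝓕(ū)(ξ) = \overline{𝓕u(-ξ)}` -/

/-- Conjugation symmetry of the Fourier integral: `𝓕(ū)(ξ) = \overline{𝓕u(-ξ)}` for every
`u : ℝ³ → ℂ³` (no integrability needed: both sides are junk `0` together). [folklore] -/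
theorem fourierIntegral_conj3_comp (f : ℝ³ → ℂ³) (ξ : ℝ³) :
    𝓕 (conj3 ∘ f) ξ = conj3 (𝓕 f (-ξ)) := by
  rw [Real.fourier_eq, Real.fourier_eq, ← conj3.integral_comp_comm]
  refine integral_congr_ae (Eventually.of_forall fun v => ?_)
  simp only [Function.comp_apply, inner_neg_right, neg_neg, Circle.smul_def, conj3_smul]
  congr 1
  rw [← Circle.coe_inv_eq_conj, ← AddChar.map_neg_eq_inv]

/-- A Schwartz field composed with conjugation is in `L¹ ∩ L²`. [folklore] -/
theorem integrable_conj3_comp (φ : 𝓢(ℝ³, ℂ³)) :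
    Integrable (conj3 ∘ ⇑φ) (volume : Measure ℝ³) :=
  conj3.toContinuousLinearMap.integrable_comp (φ.integrable)

/-- A Schwartz field composed with conjugation is in `L²`. [folklore] -/
theorem memLp_conj3_comp (φ : 𝓢(ℝ³, ℂ³)) :
    MemLp (conj3 ∘ ⇑φ) 2 (volume : Measure ℝ³) :=
  ContinuousLinearMap.comp_memLp' conj3.toContinuousLinearMap (φ.memLp 2 _)

/-- `\overline{φ}` in `L²` is the class of `conj ∘ φ`. [folklore] -/
theorem conjL2_toLp (φ : 𝓢(ℝ³, ℂ³)) :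
    conjL2 (φ.toLp 2) = (memLp_conj3_comp φ).toLp _ := by
  apply Lp.ext
  filter_upwards [coeFn_conjL2 (φ.toLp 2), φ.coeFn_toLp 2,
    MemLp.coeFn_toLp (memLp_conj3_comp φ)] with x h1 h2 h3
  rw [h1, h2, h3, Function.comp_apply]

/-- **Conjugation symmetry of the `L²` Fourier transform**: `𝓕(ū) = \overline{(𝓕u)(-·)}` in
`L²(ℝ³; ℂ³)`, for Mathlib's Plancherel extension `Lp.fourierTransformₗᵢ`. Both sides are
continuous in `u` and agree on Schwartz fields, where the `L²` transform is the Fourier integral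
(`fourier_toLp_ae_eq_fourierIntegral`) and `fourierIntegral_conj3_comp` applies. [folklore] -/
theorem fourier_conjL2 (u : L2C) : (𝓕 (conjL2 u) : L2C) = conjL2 (reflectL2 (𝓕 u : L2C)) := by
  have hd := SchwartzMap.denseRange_toLpCLM (F := ℂ³) (p := 2) (μ := (volume : Measure ℝ³))
    ENNReal.ofNat_ne_top
  refine congrFun (hd.equalizer ((continuous_fourier (E := L2C)).comp continuous_conjL2)
    (continuous_conjL2.comp (continuous_reflectL2.comp (continuous_fourier (E := L2C)))) ?_) u
  funext φ
  simp only [Function.comp_apply, SchwartzMap.toLpCLM_apply]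
  rw [conjL2_toLp, SchwartzMap.toLp_fourier_eq]
  apply Lp.ext
  have hq : Measure.QuasiMeasurePreserving (fun x : ℝ³ => -x) volume volume :=
    (Measure.measurePreserving_neg (volume : Measure ℝ³)).quasiMeasurePreserving
  filter_upwards [FunctionSpaces.fourier_toLp_ae_eq_fourierIntegral (integrable_conj3_comp φ)
      (memLp_conj3_comp φ),
    coeFn_conjL2 (reflectL2 ((𝓕 φ).toLp 2)), coeFn_reflectL2 ((𝓕 φ).toLp 2),
    hq.ae_eq ((𝓕 φ).coeFn_toLp 2 (volume : Measure ℝ³))] with ξ h1 h2 h3 h4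
  rw [h1, h2, h3, fourierIntegral_conj3_comp]
  exact congrArg conj3 (by rw [← SchwartzMap.fourier_coe]; exact h4.symm)

/-- `𝓕(ū)(ξ) = \overline{𝓕u(-ξ)}` almost everywhere, for `u ∈ L²(ℝ³; ℂ³)`. [folklore] -/
theorem fourierFn_conjL2 (u : L2C) :
    fourierFn (conjL2 u) =ᵐ[volume] fun ξ => conj3 (fourierFn u (-ξ)) := by
  unfold fourierFn
  rw [fourier_conjL2]
  filter_upwards [coeFn_conjL2 (reflectL2 (𝓕 u : L2C)), coeFn_reflectL2 (𝓕 u : L2C)]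
    with ξ h1 h2
  rw [h1, h2]

/-! ### `H¹⁰_df ⊗ ℂ` is a `ℂ`-subspace stable under conjugation -/

/-- `𝓕(c u) = c 𝓕u` almost everywhere. [folklore] -/
theorem fourierFn_smul (c : ℂ) (u : L2C) :
    fourierFn (c • u) =ᵐ[volume] fun ξ => c • fourierFn u ξ := by
  unfold fourierFn
  rw [FourierTransform.fourier_smul]
  exact Lp.coeFn_smul c (𝓕 u : L2C)

/-- `𝓕(u + v) = 𝓕u + 𝓕v` almost everywhere. [folklore] -/
theorem fourierFn_add (u v : L2C) :
    fourierFn (u + v) =ᵐ[volume] fun ξ => fourierFn u ξ + fourierFn v ξ := by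
  unfold fourierFn
  rw [FourierTransform.fourier_add]
  exact Lp.coeFn_add (𝓕 u : L2C) (𝓕 v : L2C)

/-- The weighted integral `∫ (1+|ξ|²)^s ‖ĝ(ξ)‖² dξ` defining `‖·‖_{H^s}`, as a function of a
representative `ĝ`. [folklore] -/
def sobolevWeightIntegral (s : ℝ) (g : ℝ³ → ℂ³) : ℝ≥0∞ :=
  ∫⁻ ξ, ENNReal.ofReal ((1 + ‖ξ‖ ^ 2) ^ s) * ‖g ξ‖ₑ ^ 2

/-- `‖u‖_{H^s} = (∫ (1+|ξ|²)^s ‖û‖²)^{1/2}` in terms of `fourierFn`. [folklore] -/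
theorem eFourierSobolevNorm_eq (s : ℝ) (u : L2C) :
    FunctionSpaces.eFourierSobolevNorm s u = sobolevWeightIntegral s (fourierFn u) ^ (1 / 2 : ℝ) :=
  rfl

/-- The weighted integral only depends on the a.e. class of the representative. [folklore] -/
theorem sobolevWeightIntegral_congr_ae {s : ℝ} {g g' : ℝ³ → ℂ³} (h : g =ᵐ[volume] g') :
    sobolevWeightIntegral s g = sobolevWeightIntegral s g' := by
  refine lintegral_congr_ae ?_
  filter_upwards [h] with ξ hξ
  rw [hξ]

/-- Finiteness of `‖u‖_{H^s}` is finiteness of the weighted integral. [folklore] -/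
theorem eFourierSobolevNorm_lt_top_iff (s : ℝ) (u : L2C) :
    FunctionSpaces.eFourierSobolevNorm s u < ∞ ↔ sobolevWeightIntegral s (fourierFn u) < ∞ := by
  rw [eFourierSobolevNorm_eq, ENNReal.rpow_lt_top_iff_of_pos (by norm_num)]

/-- The weighted integral scales quadratically: `∫ ρ ‖c ĝ‖² = ‖c‖² ∫ ρ ‖ĝ‖²`. [folklore] -/
theorem sobolevWeightIntegral_smul (s : ℝ) (c : ℂ) (g : ℝ³ → ℂ³) :
    sobolevWeightIntegral s (fun ξ => c • g ξ) = ‖c‖ₑ ^ 2 * sobolevWeightIntegral s g := by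
  unfold sobolevWeightIntegral
  rw [← lintegral_const_mul' _ _ (by simp)]
  refine lintegral_congr fun ξ => ?_
  rw [enorm_smul, mul_pow]
  ring

/-- `‖a + b‖² ≤ 2(‖a‖² + ‖b‖²)` in `ℝ≥0∞`. [folklore] -/
theorem enorm_add_sq_le (a b : ℂ³) : ‖a + b‖ₑ ^ 2 ≤ 2 * (‖a‖ₑ ^ 2 + ‖b‖ₑ ^ 2) := by
  have h1 : ‖a + b‖ ^ 2 ≤ (‖a‖ + ‖b‖) ^ 2 :=
    pow_le_pow_left₀ (norm_nonneg _) (norm_add_le a b) 2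
  have h : ‖a + b‖ ^ 2 ≤ 2 * (‖a‖ ^ 2 + ‖b‖ ^ 2) := by
    nlinarith [h1, sq_nonneg (‖a‖ - ‖b‖)]
  calc ‖a + b‖ₑ ^ 2 = ENNReal.ofReal (‖a + b‖ ^ 2) := by
        rw [← ofReal_norm, ENNReal.ofReal_pow (norm_nonneg _)]
    _ ≤ ENNReal.ofReal (2 * (‖a‖ ^ 2 + ‖b‖ ^ 2)) := ENNReal.ofReal_le_ofReal h
    _ = 2 * (‖a‖ₑ ^ 2 + ‖b‖ₑ ^ 2) := by
        rw [ENNReal.ofReal_mul (by norm_num), ENNReal.ofReal_add (by positivity) (by positivity),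
          ENNReal.ofReal_pow (norm_nonneg _), ENNReal.ofReal_pow (norm_nonneg _),
          ofReal_norm, ofReal_norm, ENNReal.ofReal_ofNat]

/-- The Sobolev weight `(1+|ξ|²)^s` is measurable. [folklore] -/
theorem measurable_sobolevWeight (s : ℝ) :
    Measurable fun ξ : ℝ³ => ENNReal.ofReal ((1 + ‖ξ‖ ^ 2) ^ s) :=
  ((measurable_const.add (measurable_norm.pow_const 2)).pow_const s).ennreal_ofReal

/-- The weighted integral of a sum: `∫ ρ ‖ĝ + ĥ‖² ≤ 2 (∫ ρ ‖ĝ‖² + ∫ ρ ‖ĥ‖²)` (for `ĝ`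
a.e.-strongly measurable, so that the integral splits). [folklore] -/
theorem sobolevWeightIntegral_add_le (s : ℝ) {g : ℝ³ → ℂ³} (hg : AEStronglyMeasurable g volume)
    (h : ℝ³ → ℂ³) :
    sobolevWeightIntegral s (fun ξ => g ξ + h ξ) ≤
      2 * (sobolevWeightIntegral s g + sobolevWeightIntegral s h) := by
  unfold sobolevWeightIntegral
  have hmeas : AEMeasurable
      (fun ξ : ℝ³ => 2 * (ENNReal.ofReal ((1 + ‖ξ‖ ^ 2) ^ s) * ‖g ξ‖ₑ ^ 2)) volume :=
    (((measurable_sobolevWeight s).aemeasurable).mul (hg.enorm.pow_const 2)).const_mul _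
  calc ∫⁻ ξ, ENNReal.ofReal ((1 + ‖ξ‖ ^ 2) ^ s) * ‖g ξ + h ξ‖ₑ ^ 2
      ≤ ∫⁻ ξ, (2 * (ENNReal.ofReal ((1 + ‖ξ‖ ^ 2) ^ s) * ‖g ξ‖ₑ ^ 2) +
          2 * (ENNReal.ofReal ((1 + ‖ξ‖ ^ 2) ^ s) * ‖h ξ‖ₑ ^ 2)) := by
        refine lintegral_mono fun ξ => ?_
        calc ENNReal.ofReal ((1 + ‖ξ‖ ^ 2) ^ s) * ‖g ξ + h ξ‖ₑ ^ 2
            ≤ ENNReal.ofReal ((1 + ‖ξ‖ ^ 2) ^ s) * (2 * (‖g ξ‖ₑ ^ 2 + ‖h ξ‖ₑ ^ 2)) := by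
              gcongr
              exact enorm_add_sq_le _ _
          _ = _ := by ring
    _ = (2 * ∫⁻ ξ, ENNReal.ofReal ((1 + ‖ξ‖ ^ 2) ^ s) * ‖g ξ‖ₑ ^ 2) +
          2 * ∫⁻ ξ, ENNReal.ofReal ((1 + ‖ξ‖ ^ 2) ^ s) * ‖h ξ‖ₑ ^ 2 := by
        rw [lintegral_add_left' hmeas, lintegral_const_mul' _ _ (by simp),
          lintegral_const_mul' _ _ (by simp)]
    _ = _ := by rw [mul_add]

/-- The weighted integral is invariant under reflection `ĝ ↦ ĝ(-·)` (the weight is even and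
Lebesgue measure is invariant under `ξ ↦ -ξ`). [folklore] -/
theorem sobolevWeightIntegral_reflect (s : ℝ) (g : ℝ³ → ℂ³) :
    sobolevWeightIntegral s (fun ξ => g (-ξ)) = sobolevWeightIntegral s g := by
  unfold sobolevWeightIntegral
  conv_rhs => rw [← lintegral_neg_eq_self]
  simp only [norm_neg]

/-- The weighted integral is invariant under conjugation of the values. [folklore] -/
theorem sobolevWeightIntegral_conj3 (s : ℝ) (g : ℝ³ → ℂ³) :
    sobolevWeightIntegral s (fun ξ => conj3 (g ξ)) = sobolevWeightIntegral s g := by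
  unfold sobolevWeightIntegral
  simp only [← ofReal_norm, LinearIsometry.norm_map]

/-! ### `H¹⁰_df ⊗ ℂ` is a `ℂ`-subspace of `L²` stable under conjugation -/

/-- `cdot` is additive in its second argument. [folklore] -/
theorem cdot_add_right (a b c : ℂ³) : cdot a (b + c) = cdot a b + cdot a c := by
  simp [cdot, mul_add, Finset.sum_add_distrib]

/-- `cdot` is odd in its first argument. [folklore] -/
theorem cdot_neg_left (a b : ℂ³) : cdot (-a) b = -cdot a b := by
  simp [cdot, Finset.sum_neg_distrib]

/-- `û` is a.e.-strongly measurable. [folklore] -/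
theorem aestronglyMeasurable_fourierFn (u : L2C) : AEStronglyMeasurable (fourierFn u) volume :=
  Lp.aestronglyMeasurable _

/-- `H¹⁰_df ⊗ ℂ` is stable under complex scalars. [folklore] -/
theorem MemH10dfC.smul {w : L2C} (hw : MemH10dfC w) (c : ℂ) : MemH10dfC (c • w) := by
  refine ⟨?_, ?_⟩
  · rw [eFourierSobolevNorm_lt_top_iff, sobolevWeightIntegral_congr_ae (fourierFn_smul c w),
      sobolevWeightIntegral_smul]
    exact ENNReal.mul_lt_top (ENNReal.pow_lt_top enorm_lt_top)
      ((eFourierSobolevNorm_lt_top_iff _ _).1 hw.1)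
  · unfold IsFourierDivFree
    filter_upwards [hw.2, fourierFn_smul c w] with ξ h1 h2
    rw [h2, cdot_smul_right, h1, mul_zero]

/-- `H¹⁰_df ⊗ ℂ` is stable under addition. [folklore] -/
theorem MemH10dfC.add {w w' : L2C} (hw : MemH10dfC w) (hw' : MemH10dfC w') :
    MemH10dfC (w + w') := by
  refine ⟨?_, ?_⟩
  · rw [eFourierSobolevNorm_lt_top_iff, sobolevWeightIntegral_congr_ae (fourierFn_add w w')]
    refine lt_of_le_of_lt
      (sobolevWeightIntegral_add_le 10 (aestronglyMeasurable_fourierFn w) (fourierFn w')) ?_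
    exact ENNReal.mul_lt_top (by simp) (ENNReal.add_lt_top.2
      ⟨(eFourierSobolevNorm_lt_top_iff _ _).1 hw.1, (eFourierSobolevNorm_lt_top_iff _ _).1 hw'.1⟩)
  · unfold IsFourierDivFree
    filter_upwards [hw.2, hw'.2, fourierFn_add w w'] with ξ h1 h2 h3
    rw [h3, cdot_add_right, h1, h2, add_zero]

/-- `H¹⁰_df ⊗ ℂ` is stable under conjugation `w ↦ w̄` (`‖w̄‖_{H¹⁰} = ‖w‖_{H¹⁰}` since the
weight is even; `ξ · \overline{ŵ(-ξ)} = \overline{ξ · ŵ(-ξ)} = 0`). [folklore] -/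
theorem MemH10dfC.conj {w : L2C} (hw : MemH10dfC w) : MemH10dfC (conjL2 w) := by
  refine ⟨?_, ?_⟩
  · rw [eFourierSobolevNorm_lt_top_iff, sobolevWeightIntegral_congr_ae (fourierFn_conjL2 w),
      sobolevWeightIntegral_conj3 10 (fun ξ => fourierFn w (-ξ)), sobolevWeightIntegral_reflect]
    exact (eFourierSobolevNorm_lt_top_iff _ _).1 hw.1
  · unfold IsFourierDivFree
    have hq := (Measure.measurePreserving_neg (volume : Measure ℝ³)).quasiMeasurePreserving
    have h0 := hq.ae hw.2
    filter_upwards [h0, fourierFn_conjL2 w] with ξ h1 h2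
    have h1' : cdot (FunctionSpaces.EuclideanSpace.complexify ξ) (fourierFn w (-ξ)) = 0 := by
      rw [map_neg, cdot_neg_left, neg_eq_zero] at h1
      exact h1
    rw [h2, cdot_conj3_right, conj3_complexify, h1', map_zero]

/-! ### `H¹⁰_df ⊗ ℂ = H¹⁰_df ⊕ i H¹⁰_df` -/

/-- The real part `Re w = (w + w̄)/2` of a complexified field. [folklore] -/
def reL2 (w : L2C) : L2C := ((2 : ℂ)⁻¹) • (w + conjL2 w)

/-- The imaginary part `Im w = (w - w̄)/(2i) = (i/2)(w̄ - w)` of a complexified field. [folklore] -/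
def imL2 (w : L2C) : L2C := ((2 : ℂ)⁻¹ * Complex.I) • (conjL2 w - w)

/-- `(z + z̄)/2 = Re z`. [folklore] -/
theorem two_inv_mul_add_conj (z : ℂ) : (2 : ℂ)⁻¹ * (z + conj z) = ((z.re : ℝ) : ℂ) := by
  rw [Complex.add_conj]
  push_cast
  ring

/-- `(i/2)(z̄ - z) = Im z`. [folklore] -/
theorem two_inv_mul_I_mul_conj_sub (z : ℂ) :
    (2 : ℂ)⁻¹ * Complex.I * (conj z - z) = ((z.im : ℝ) : ℂ) := by
  rw [← neg_sub, Complex.sub_conj]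
  push_cast
  ring_nf
  rw [Complex.I_sq]
  ring

/-- `Re w` is a real field. [folklore] -/
theorem isReal_reL2 (w : L2C) : IsReal (reL2 w) := by
  unfold IsReal reL2
  filter_upwards [Lp.coeFn_smul ((2 : ℂ)⁻¹) (w + conjL2 w), Lp.coeFn_add w (conjL2 w),
    coeFn_conjL2 w] with x h1 h2 h3
  intro i
  rw [h1, Pi.smul_apply, h2, Pi.add_apply, h3, PiLp.smul_apply, PiLp.add_apply, conj3_apply,
    smul_eq_mul, two_inv_mul_add_conj, Complex.ofReal_im]

/-- `Im w` is a real field. [folklore] -/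
theorem isReal_imL2 (w : L2C) : IsReal (imL2 w) := by
  unfold IsReal imL2
  filter_upwards [Lp.coeFn_smul ((2 : ℂ)⁻¹ * Complex.I) (conjL2 w - w),
    Lp.coeFn_sub (conjL2 w) w, coeFn_conjL2 w] with x h1 h2 h3
  intro i
  rw [h1, Pi.smul_apply, h2, Pi.sub_apply, h3, PiLp.smul_apply, PiLp.sub_apply, conj3_apply,
    smul_eq_mul, two_inv_mul_I_mul_conj_sub, Complex.ofReal_im]

/-- `Re w ∈ H¹⁰_df` for `w ∈ H¹⁰_df ⊗ ℂ`. [folklore] -/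
theorem MemH10dfC.memH10df_reL2 {w : L2C} (hw : MemH10dfC w) : MemH10df (reL2 w) :=
  have h : MemH10dfC (reL2 w) := (hw.add hw.conj).smul _
  ⟨h.1, isReal_reL2 w, h.2⟩

/-- `Im w ∈ H¹⁰_df` for `w ∈ H¹⁰_df ⊗ ℂ`. [folklore] -/
theorem MemH10dfC.memH10df_imL2 {w : L2C} (hw : MemH10dfC w) : MemH10df (imL2 w) := by
  have h : MemH10dfC (imL2 w) := by
    have h' : MemH10dfC (conjL2 w - w) := by
      rw [sub_eq_add_neg, ← neg_one_smul ℂ w]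
      exact hw.conj.add (hw.smul _)
    exact h'.smul _
  exact ⟨h.1, isReal_imL2 w, h.2⟩

/-- `w = Re w + i Im w`. [folklore] -/
theorem reL2_add_I_smul_imL2 (w : L2C) : reL2 w + Complex.I • imL2 w = w := by
  apply Lp.ext
  filter_upwards [Lp.coeFn_add (reL2 w) (Complex.I • imL2 w),
    Lp.coeFn_smul Complex.I (imL2 w), Lp.coeFn_smul ((2 : ℂ)⁻¹) (w + conjL2 w),
    Lp.coeFn_add w (conjL2 w), Lp.coeFn_smul ((2 : ℂ)⁻¹ * Complex.I) (conjL2 w - w),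
    Lp.coeFn_sub (conjL2 w) w, coeFn_conjL2 w] with x h1 h2 h3 h4 h5 h6 h7
  rw [h1, Pi.add_apply, h2, Pi.smul_apply, reL2, h3, Pi.smul_apply, h4, Pi.add_apply, imL2, h5,
    Pi.smul_apply, h6, Pi.sub_apply, h7]
  ext i
  simp only [PiLp.add_apply, PiLp.smul_apply, PiLp.sub_apply, conj3_apply, smul_eq_mul]
  linear_combination ((conj ((w : ℝ³ → ℂ³) x i) - (w : ℝ³ → ℂ³) x i) / 2) * Complex.I_mul_I

/-- **`H¹⁰_df ⊗ ℂ = H¹⁰_df ⊕ i H¹⁰_df`**: every `w ∈ L²(ℝ³; ℂ³)` of finite `H¹⁰` norm with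
`ξ · ŵ(ξ) = 0` a.e. is `w₁ + i w₂` with `w₁ = Re w`, `w₂ = Im w ∈ H¹⁰_df` (real, finite `H¹⁰`
norm, divergence free). This is the statement of the named fact `memH10dfC_decomposition` in the
decomposition of Tao's Theorem 3.2 (the meaning of the complexification `H¹⁰_df(ℝ³) ⊗ ℂ`,
Tao 2016 pp. 6, 15). [cite: Tao2016AveragedNS, §3.1 Def. 3.4] -/
theorem MemH10dfC.decompose {w : L2C} (hw : MemH10dfC w) :
    ∃ w₁ w₂ : L2C, MemH10df w₁ ∧ MemH10df w₂ ∧ w = w₁ + Complex.I • w₂ :=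
  ⟨reL2 w, imL2 w, hw.memH10df_reL2, hw.memH10df_imL2, (reL2_add_I_smul_imL2 w).symm⟩

end Literature.Analysis.FluidPDE.Tao2016
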